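import Literature.MathematicalPhysics.QuantumLattice.ApproximatingHamiltonianProofs
import Literature.Analysis.Complex.LeeYangConeDominationLocal
import HarnessLib

/-!
# The partition function in a complex source and the Lee–Yang-cone bound on the non-linear response

Topic `Literature/MathematicalPhysics/QuantumLattice` (matrix analysis behind the quantum-lattice
statements; companions `FinDimSpectrum.lean`, `DuhamelTwoPoint(Proofs).lean`,
`TraceInequalities(Proofs).lean`).

For a finite-dimensional Hamiltonian `H` and a source observable `Q` (both Hermitian) the sourced
partition function `Z(h) = tr e^{-β(H - hQ)} = Matrix.partitionFn β (H - h • Q)` makes sense for a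
COMPLEX source `h : ℂ`. This file records:

* `differentiable_partitionFn_sub_smul` — `h ↦ Z(h)` is entire; `exists_norm_partitionFn_sub_smul_le`
  — it has exponential type (`‖Z(h)‖ ≤ card · e^{‖βH‖ + ‖βQ‖‖h‖}`, packaged as order `≤ 3/2 < 2`);
* `norm_partitionFn_complexSource_le_re` — **the real axis dominates** (Petz 1994, Cor. 6, the
  tree's `norm_trace_exp_add_I_smul_le`): `|Z(s + iy)| ≤ Z(s)` for real `s, y` and `β ≥ 0`;
* `conj_eq_smul_of_grading` / `partitionFn_sub_neg_smul_eq` — **evenness from a symmetry**: if an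
  invertible `W` fixes `H` and flips `Q` (`W H W⁻¹ = H`, `W Q W⁻¹ = -Q`) then `Z(-h) = Z(h)`; such a
  `W = e^{cN}` exists whenever a diagonal grading `N` commutes with `H` and shifts the two halves
  of `Q = Q₋ + Q₋ᴴ` by `∓q` (`[N, Q₋] = -q Q₋`, `e^{-cq} = -1`) — the `U(1)` gauge rotation for a pair
  source;
* `deriv_partitionFn_sub_smul_ofReal`, `iteratedDeriv_two_partitionFn_sub_smul` — `Z'(0) = β Z ⟨Q⟩`,
  `Z''(0) = β² Z · (Q,Q)_Duhamel` (from the real-variable Duhamel calculus of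
  `DuhamelTwoPointProofs.lean` and uniqueness of derivatives of the entire `Z`); under evenness
  `⟨Q⟩ = 0` (`gibbsState_eq_zero_of_even`);
* **Theorem** `log_partitionFn_sub_smul_sub_le_of_zeros_in_cone` — if `Z` is even and all its complex
  zeros lie in the cone `(1 + κ)(Re h)² ≤ (1 - κ)(Im h)²` (`κ = 1`: Lee–Yang, zeros purely imaginary),
  then for every real `s`

    `log Z(H - sQ) - log Z(H) ≤ (s² β² / (2κ)) · [(Q,Q)_Duhamel - ⟨Q⟩²]`,

  i.e. the Kubo–Mori–Bogoliubov linear response at zero source bounds the full non-linear response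
  (`Literature.Analysis.Complex.norm_le_exp_sq_of_even_of_zeros_in_cone`, the cone version of
  Newman's "Lee–Yang ⇒ GHS-type inequalities"); and its LOCAL form
  `log_partitionFn_sub_smul_sub_le_of_zeros_in_cone_near` — the cone condition only for the zeros
  in the disc `|h| ≤ r₀`, at the price of the far-zero constant `Φ = 7β‖Q‖/(r₀ log 2)` (Jensen
  counting; the real-axis domination and the Lipschitz bound `log Z(H - sQ) - log Z(H) ≤ β‖Q‖|s|`
  needed by `Literature.Analysis.Complex.norm_le_exp_sq_of_even_of_zeros_in_cone_near` are
  automatic here). Specialised to the `d`-wave pair source of the Hubbard torus in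
  `DWaveSourceLeeYang.lean`.

## References

* T. D. Lee, C. N. Yang, Phys. Rev. 87 (1952) 410; C. M. Newman, Comm. Math. Phys. 41 (1975) 1,
  Thm. 3.
* D. Petz, *A survey of certain trace inequalities*, Banach Center Publ. 30 (1994) 287, Cor. 6.
* F. J. Dyson, E. H. Lieb, B. Simon, J. Stat. Phys. 18 (1978) 335, §3 (Duhamel two-point function).
-/

noncomputable section

open scoped Matrix.Norms.L2Operator ComplexOrder
open Matrix Finset MeasureTheory intervalIntegral Filter NormedSpace
open _root_.Topology

namespace Literature.MathematicalPhysics.QuantumLattice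

variable {n : Type*} [Fintype n] [DecidableEq n]

/-! ### The sourced exponent -/

omit [Fintype n] [DecidableEq n] in
/-- `-β(H - hQ) = (-βH) + h • (βQ)`. [folklore] -/
theorem neg_smul_sub_smul_eq (β : ℝ) (H Q : Matrix n n ℂ) (h : ℂ) :
    -(β : ℂ) • (H - h • Q) = -(β : ℂ) • H + h • ((β : ℂ) • Q) := by
  rw [smul_sub, smul_smul, smul_smul, mul_comm h]
  simp [sub_eq_add_neg, neg_smul]

/-- Unfolding: `Z(h) = tr exp((-βH) + h • (βQ))`. [folklore] -/
theorem partitionFn_sub_smul_eq (β : ℝ) (H Q : Matrix n n ℂ) (h : ℂ) :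
    partitionFn β (H - h • Q) = (exp (-(β : ℂ) • H + h • ((β : ℂ) • Q))).trace := by
  rw [partitionFn, gibbsWeight, neg_smul_sub_smul_eq]

/-! ### `h ↦ Z(h)` is entire of exponential type -/

/-- `h ↦ tr (C e^{A + hY})` is complex-differentiable (the exponential is analytic on the Banach
algebra of matrices). [folklore] -/
theorem differentiable_trace_mul_exp_add_smul (C A Y : Matrix n n ℂ) :
    Differentiable ℂ fun h : ℂ => (C * exp (A + h • Y)).trace := by
  intro h
  have h1 : DifferentiableAt ℂ (fun h : ℂ => A + h • Y) h :=
    (differentiableAt_id.smul_const Y).const_add A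
  have h2 : DifferentiableAt ℂ (fun X : Matrix n n ℂ => exp X) (A + h • Y) :=
    (NormedSpace.exp_analytic (𝕂 := ℂ) (A + h • Y)).differentiableAt
  have h3 : DifferentiableAt ℂ (fun h : ℂ => exp (A + h • Y)) h := h2.comp h h1
  set L : Matrix n n ℂ →L[ℂ] ℂ := LinearMap.toContinuousLinearMap
    ((Matrix.traceLinearMap n ℂ ℂ) ∘ₗ (LinearMap.mulLeft ℂ C)) with hL
  have hLapply : ∀ X : Matrix n n ℂ, L X = (C * X).trace := fun X => rfl
  have h4 : DifferentiableAt ℂ (fun h : ℂ => L (exp (A + h • Y))) h :=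
    L.differentiable.differentiableAt.comp h h3
  exact h4

/-- **`Z(h) = tr e^{-β(H - hQ)}` is an entire function of the complex source `h`.** [folklore] -/
theorem differentiable_partitionFn_sub_smul (β : ℝ) (H Q : Matrix n n ℂ) :
    Differentiable ℂ fun h : ℂ => partitionFn β (H - h • Q) := by
  have h := differentiable_trace_mul_exp_add_smul 1 (-(β : ℂ) • H) ((β : ℂ) • Q)
  simp only [Matrix.one_mul] at h
  have heq : (fun h : ℂ => partitionFn β (H - h • Q)) =
      fun h : ℂ => (exp (-(β : ℂ) • H + h • ((β : ℂ) • Q))).trace :=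
    funext fun h => partitionFn_sub_smul_eq β H Q h
  rw [heq]; exact h

/-- `|tr X| ≤ card · ‖X‖` (operator norm; inequality ii) of Koma–Tasaki with `P = 1`). [folklore] -/
theorem norm_trace_le_card_mul_norm (X : Matrix n n ℂ) :
    ‖X.trace‖ ≤ Fintype.card n * ‖X‖ := by
  have h := norm_trace_mul_le_opNorm_mul_re_trace X (PosSemidef.one (n := n) (R := ℂ))
  rw [Matrix.mul_one, trace_one] at h
  simpa [mul_comm] using h

/-- For `0 ≤ b, r`: `b r ≤ r^{3/2} + b³` (split at `r = b²`). [folklore] -/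
theorem mul_le_rpow_three_halves_add_cube {b r : ℝ} (hb : 0 ≤ b) (hr : 0 ≤ r) :
    b * r ≤ r ^ (3 / 2 : ℝ) + b ^ 3 := by
  have hr32 : r ^ (3 / 2 : ℝ) = r * Real.sqrt r := by
    rcases hr.lt_or_eq with hr0 | hr0
    · rw [show (3 / 2 : ℝ) = 1 + 1 / 2 by norm_num, Real.rpow_add hr0, Real.rpow_one,
        Real.sqrt_eq_rpow]
    · rw [← hr0]; simp
  rw [hr32]
  by_cases hcase : r ≤ b ^ 2
  · have : b * r ≤ b ^ 3 := by nlinarith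
    nlinarith [mul_nonneg hr (Real.sqrt_nonneg r)]
  · have hcase : b ^ 2 < r := lt_of_not_ge hcase
    have hsq : b ≤ Real.sqrt r := by
      rw [show b = Real.sqrt (b ^ 2) by rw [Real.sqrt_sq hb]]
      exact Real.sqrt_le_sqrt hcase.le
    nlinarith [pow_nonneg hb 3, mul_le_mul_of_nonneg_left hsq hr]

/-- **Exponential type.** `‖Z(h)‖ ≤ card · exp(‖βH‖ + ‖βQ‖ ‖h‖)`, packaged in the order-`3/2` form
consumed by `Literature.Analysis.Complex.norm_le_exp_sq_of_even_of_zeros_in_cone`. [folklore] -/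
theorem exists_norm_partitionFn_sub_smul_le (β : ℝ) (H Q : Matrix n n ℂ) :
    ∃ C : ℝ, ∀ h : ℂ, ‖partitionFn β (H - h • Q)‖ ≤ C * Real.exp (‖h‖ ^ (3 / 2 : ℝ)) := by
  classical
  set a : ℝ := ‖-(β : ℂ) • H‖ with ha
  set b : ℝ := ‖(β : ℂ) • Q‖ with hb
  refine ⟨Fintype.card n * Real.exp (a + b ^ 3), fun h => ?_⟩
  rw [partitionFn_sub_smul_eq]
  have hX : ‖-(β : ℂ) • H + h • ((β : ℂ) • Q)‖ ≤ a + b * ‖h‖ := by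
    calc ‖-(β : ℂ) • H + h • ((β : ℂ) • Q)‖ ≤ ‖-(β : ℂ) • H‖ + ‖h • ((β : ℂ) • Q)‖ :=
          norm_add_le _ _
      _ = a + b * ‖h‖ := by rw [ha, hb, norm_smul h ((β : ℂ) • Q), mul_comm ‖h‖]
  cases isEmpty_or_nonempty n with
  | inl hn =>
    have : (exp (-(β : ℂ) • H + h • ((β : ℂ) • Q))).trace = 0 := by
      simp [Matrix.trace]
    rw [this, norm_zero]
    positivity
  | inr hn =>
    calc ‖(exp (-(β : ℂ) • H + h • ((β : ℂ) • Q))).trace‖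
        ≤ Fintype.card n * ‖exp (-(β : ℂ) • H + h • ((β : ℂ) • Q))‖ := norm_trace_le_card_mul_norm _
      _ ≤ Fintype.card n * Real.exp (a + b * ‖h‖) := by
          gcongr
          exact (norm_exp_le ℂ _).trans (Real.exp_le_exp.2 hX)
      _ ≤ Fintype.card n * (Real.exp (a + b ^ 3) * Real.exp (‖h‖ ^ (3 / 2 : ℝ))) := by
          gcongr
          rw [← Real.exp_add]
          exact Real.exp_le_exp.2 (by
            linarith [mul_le_rpow_three_halves_add_cube (norm_nonneg ((β : ℂ) • Q)) (norm_nonneg h)])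
      _ = Fintype.card n * Real.exp (a + b ^ 3) * Real.exp (‖h‖ ^ (3 / 2 : ℝ)) := by ring

/-! ### The real axis dominates (Petz) -/

/-- **`|Z(s + iy)| ≤ Z(s)`** for Hermitian `H, Q` and every real `β`: with
`A = -β(H - sQ)` Hermitian and `B = βy Q` Hermitian, `-β(H - (s+iy)Q) = A + iB` and Petz's
Corollary 6 (`norm_trace_exp_add_I_smul_le`) applies. [cite: Petz1994, Corollary 6] -/
theorem norm_partitionFn_complexSource_le_re (β : ℝ) {H Q : Matrix n n ℂ} (hH : H.IsHermitian)
    (hQ : Q.IsHermitian) (s y : ℝ) :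
    ‖partitionFn β (H - ((s : ℂ) + (y : ℂ) * Complex.I) • Q)‖ ≤
      (partitionFn β (H - (s : ℂ) • Q)).re := by
  set A : Matrix n n ℂ := -(β : ℂ) • H + (s : ℂ) • ((β : ℂ) • Q) with hA
  set B : Matrix n n ℂ := ((β * y : ℝ) : ℂ) • Q with hB
  have hAh : A.IsHermitian := by
    have h1 : (-(β : ℂ) • H).IsHermitian := isHermitian_neg_smul β hH
    have h2 : ((s : ℂ) • ((β : ℂ) • Q)).IsHermitian := by
      rw [smul_smul, show (s : ℂ) * (β : ℂ) = ((s * β : ℝ) : ℂ) by push_cast; ring]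
      exact isHermitian_real_smul hQ _
    exact h1.add h2
  have hBh : B.IsHermitian := isHermitian_real_smul hQ _
  have h := norm_trace_exp_add_I_smul_le A B hAh hBh
  have hlhs : -(β : ℂ) • H + ((s : ℂ) + (y : ℂ) * Complex.I) • ((β : ℂ) • Q) =
      A + Complex.I • B := by
    rw [hA, hB]
    ext i j
    simp only [Matrix.add_apply, Matrix.smul_apply, smul_eq_mul]
    push_cast
    ring
  rw [partitionFn_sub_smul_eq, partitionFn_sub_smul_eq, hlhs]
  exact h

/-! ### Evenness from a symmetry -/

/-- **Conjugation by a symmetry that flips the source reverses the source**: if `W` is invertible,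
`W H W⁻¹ = H` and `W Q W⁻¹ = -Q`, then `Z(-h) = Z(h)` for every complex `h`
(`e^{W X W⁻¹} = W e^X W⁻¹`, cyclicity of the trace). [folklore] -/
theorem partitionFn_sub_neg_smul_eq (β : ℝ) {H Q W : Matrix n n ℂ} (hW : IsUnit W)
    (hWH : W * H * W⁻¹ = H) (hWQ : W * Q * W⁻¹ = -Q) (h : ℂ) :
    partitionFn β (H - (-h) • Q) = partitionFn β (H - h • Q) := by
  have hconj : W * (-(β : ℂ) • (H - h • Q)) * W⁻¹ = -(β : ℂ) • (H - (-h) • Q) := by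
    rw [Matrix.mul_smul, Matrix.smul_mul, Matrix.mul_sub, Matrix.sub_mul, hWH, Matrix.mul_smul,
      Matrix.smul_mul, hWQ]
    simp [smul_neg, neg_smul]
  rw [partitionFn, partitionFn, gibbsWeight, gibbsWeight, ← hconj, Matrix.exp_conj _ _ hW,
    trace_mul_cycle, Matrix.nonsing_inv_mul _ ((Matrix.isUnit_iff_isUnit_det W).1 hW),
    Matrix.one_mul]

/-- **A grading produces the symmetry.** Let `N = diagonal d` and suppose
`N A - A N = q • A` (the observable `A` shifts the grading by `q`). Then for every `c : ℂ`,
`e^{cN} A e^{-cN} = e^{cq} A`, written with the explicit diagonal matrices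
`diagonal (exp (c dᵢ))`, `diagonal (exp (-c dᵢ))`. [folklore] -/
theorem conj_eq_smul_of_grading (d : n → ℂ) {A : Matrix n n ℂ} {q : ℂ}
    (hA : diagonal d * A - A * diagonal d = q • A) (c : ℂ) :
    diagonal (fun i => Complex.exp (c * d i)) * A * diagonal (fun i => Complex.exp (-(c * d i))) =
      Complex.exp (c * q) • A := by
  ext i j
  have hij : (d i - d j) * A i j = q * A i j := by
    have h := congrFun (congrFun hA i) j
    simp only [Matrix.sub_apply, diagonal_mul, mul_diagonal, Matrix.smul_apply, smul_eq_mul] at h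
    linear_combination h
  simp only [diagonal_mul, mul_diagonal, Matrix.smul_apply, smul_eq_mul]
  by_cases hA0 : A i j = 0
  · simp [hA0]
  · have hdq : d i - d j = q := mul_right_cancel₀ hA0 hij
    rw [← hdq, show Complex.exp (c * d i) * A i j * Complex.exp (-(c * d j)) =
      (Complex.exp (c * d i) * Complex.exp (-(c * d j))) * A i j by ring, ← Complex.exp_add]
    congr 1
    ring_nf

/-- The explicit diagonal matrices of `conj_eq_smul_of_grading` are mutually inverse, and the
first is invertible. [folklore] -/
theorem diagonal_exp_mul_diagonal_exp_neg (d : n → ℂ) (c : ℂ) :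
    diagonal (fun i => Complex.exp (c * d i)) * diagonal (fun i => Complex.exp (-(c * d i))) = 1 := by
  rw [diagonal_mul_diagonal, ← diagonal_one]
  congr 1
  funext i
  rw [← Complex.exp_add, add_neg_cancel, Complex.exp_zero]

/-- **Evenness of the sourced partition function from a `U(1)`-type grading.** If `N = diagonal d`
commutes with `H`, and `Q = Q₋ + Q₋ᴴ` with `N Q₋ - Q₋ N = -q • Q₋`, `N Q₋ᴴ - Q₋ᴴ N = q • Q₋ᴴ` and
`e^{cq} = -1` for some `c`, then `Z(-h) = Z(h)` for all complex `h` (for a fermionic PAIR source: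
`N` the particle number, `q = 2`, `c = iπ/2`). [folklore] -/
theorem partitionFn_sub_neg_smul_eq_of_grading (β : ℝ) {H Qm : Matrix n n ℂ} (d : n → ℂ)
    {q c : ℂ} (hH : diagonal d * H - H * diagonal d = 0)
    (hQm : diagonal d * Qm - Qm * diagonal d = -q • Qm)
    (hQp : diagonal d * Qmᴴ - Qmᴴ * diagonal d = q • Qmᴴ) (hc : Complex.exp (c * q) = -1) (h : ℂ) :
    partitionFn β (H - (-h) • (Qm + Qmᴴ)) = partitionFn β (H - h • (Qm + Qmᴴ)) := by
  set W : Matrix n n ℂ := diagonal (fun i => Complex.exp (c * d i)) with hW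
  set W' : Matrix n n ℂ := diagonal (fun i => Complex.exp (-(c * d i))) with hW'
  have hWW' : W * W' = 1 := diagonal_exp_mul_diagonal_exp_neg d c
  have hWu : IsUnit W :=
    (Matrix.isUnit_iff_isUnit_det W).2 (Matrix.isUnit_det_of_right_inverse hWW')
  have hWinv : W⁻¹ = W' := Matrix.inv_eq_right_inv hWW'
  have hcH : W * H * W⁻¹ = H := by
    rw [hWinv, hW, hW', conj_eq_smul_of_grading d (q := 0) (by simpa using hH) c]
    simp
  have hcQ : W * (Qm + Qmᴴ) * W⁻¹ = -(Qm + Qmᴴ) := by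
    rw [hWinv, hW, hW', Matrix.mul_add, Matrix.add_mul, conj_eq_smul_of_grading d hQm c,
      conj_eq_smul_of_grading d hQp c]
    have hc' : Complex.exp (c * -q) = -1 := by
      have h1 : Complex.exp (c * -q) * Complex.exp (c * q) = 1 := by
        rw [← Complex.exp_add]; ring_nf; exact Complex.exp_zero
      rw [hc] at h1
      linear_combination -h1
    rw [hc, hc', neg_one_smul, neg_one_smul, neg_add]
  exact partitionFn_sub_neg_smul_eq β hWu hcH hcQ h

/-! ### Derivatives at the origin: `Z'(0) = βZ⟨Q⟩`, `Z''(0) = β² Z (Q,Q)` -/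

/-- The complex derivative of `Z` at a real point is the Duhamel/cyclicity value
`Z'(t) = tr(βQ e^{-β(H - tQ)})`. [folklore] -/
theorem deriv_partitionFn_sub_smul_ofReal (β : ℝ) (H Q : Matrix n n ℂ) (t : ℝ) :
    deriv (fun h : ℂ => partitionFn β (H - h • Q)) (t : ℂ) =
      (((β : ℂ) • Q) * exp (-(β : ℂ) • H + (t : ℂ) • ((β : ℂ) • Q))).trace := by
  set F : ℂ → ℂ := fun h => partitionFn β (H - h • Q) with hF
  have hFd : Differentiable ℂ F := differentiable_partitionFn_sub_smul β H Q
  -- real restriction of `F` and its derivative from `DuhamelTwoPointProofs`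
  have h1 : HasDerivAt (fun u : ℝ => F (u : ℂ)) (deriv F (t : ℂ)) t :=
    (hFd (t : ℂ)).hasDerivAt.comp_ofReal
  have h2 : HasDerivAt (fun u : ℝ => (exp (-(β : ℂ) • H + u • ((β : ℂ) • Q))).trace)
      ((((β : ℂ) • Q) * exp (-(β : ℂ) • H + t • ((β : ℂ) • Q))).trace) t :=
    hasDerivAt_trace_exp_add_smul _ _ t
  have heq : (fun u : ℝ => F (u : ℂ)) =
      fun u : ℝ => (exp (-(β : ℂ) • H + u • ((β : ℂ) • Q))).trace := by
    funext u
    rw [hF]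
    simp only
    rw [partitionFn_sub_smul_eq, Complex.coe_smul]
  rw [heq] at h1
  have h := h1.unique h2
  rw [h, ← Complex.coe_smul t ((β : ℂ) • Q)]

/-- `h ↦ tr(Y e^{A + hY})`-type functions: the real restriction of the complex derivative of `Z`
agrees with the tree's real-variable derivative, so the SECOND complex derivative at `0` is the
Duhamel integral: `Z''(0) = β² ∫₀¹ tr(Q e^{-sβH} Q e^{-(1-s)βH}) ds`. [cite: DLS1978, eq. (5)] -/
theorem iteratedDeriv_two_partitionFn_sub_smul (β : ℝ) (H Q : Matrix n n ℂ) :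
    iteratedDeriv 2 (fun h : ℂ => partitionFn β (H - h • Q)) 0 =
      (β : ℂ) ^ 2 * ∫ s in (0 : ℝ)..1,
        (Q * gibbsWeight (s * β) H * Q * gibbsWeight ((1 - s) * β) H).trace := by
  set F : ℂ → ℂ := fun h => partitionFn β (H - h • Q) with hF
  have hFd : Differentiable ℂ F := differentiable_partitionFn_sub_smul β H Q
  -- `deriv F` is differentiable at `0` (holomorphic functions are smooth)
  have hdFd : DifferentiableAt ℂ (deriv F) 0 := ((hFd.analyticAt 0).deriv).differentiableAt
  have h1 : HasDerivAt (fun u : ℝ => deriv F (u : ℂ)) (deriv (deriv F) 0) 0 := by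
    have := hdFd.hasDerivAt.comp_ofReal (z := 0)
    simpa using this
  -- on the real axis `deriv F` is the tree's real-variable function `u ↦ tr(βQ e^{-βH + u βQ})`
  have heq : (fun u : ℝ => deriv F (u : ℂ)) =
      fun u : ℝ => (((β : ℂ) • Q) * exp (-(β : ℂ) • H + u • ((β : ℂ) • Q))).trace := by
    funext u
    rw [deriv_partitionFn_sub_smul_ofReal β H Q u]
    simp only [Complex.coe_smul]
  rw [heq] at h1
  have h2 := hasDerivAt_trace_mul_exp_add_smul ((β : ℂ) • Q) (-(β : ℂ) • H) ((β : ℂ) • Q) 0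
  simp only [zero_smul, add_zero] at h2
  have h := h1.unique h2
  rw [iteratedDeriv_succ, iteratedDeriv_one, h]
  have key : ∀ s : ℝ, (((β : ℂ) • Q) * (exp (s • (-(β : ℂ) • H)) * ((β : ℂ) • Q) *
      exp ((1 - s) • (-(β : ℂ) • H)))).trace =
      (β : ℂ) ^ 2 * (Q * gibbsWeight (s * β) H * Q * gibbsWeight ((1 - s) * β) H).trace := by
    intro s
    rw [exp_smul_neg_smul_eq_gibbsWeight, exp_smul_neg_smul_eq_gibbsWeight]
    simp only [Matrix.smul_mul, Matrix.mul_smul, trace_smul, smul_eq_mul, Matrix.mul_assoc]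
    ring
  simp_rw [key]
  rw [intervalIntegral.integral_const_mul]

/-- `Z''(0) = β² Z · (Q,Q)_Duhamel` for Hermitian `H` on a nonempty system. [cite: DLS1978, eq. (5)] -/
theorem iteratedDeriv_two_partitionFn_sub_smul_eq_duhamel (β : ℝ) {H : Matrix n n ℂ}
    (hH : H.IsHermitian) [Nonempty n] (Q : Matrix n n ℂ) :
    iteratedDeriv 2 (fun h : ℂ => partitionFn β (H - h • Q)) 0 =
      (β : ℂ) ^ 2 * partitionFn β H * duhamel β H Q Q := by
  rw [iteratedDeriv_two_partitionFn_sub_smul, duhamel, mul_assoc, ← mul_assoc (partitionFn β H),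
    mul_inv_cancel₀ (partitionFn_pos β hH).ne', one_mul]

/-- `Z'(0) = β Z ⟨Q⟩`. [folklore] -/
theorem deriv_partitionFn_sub_smul_zero (β : ℝ) {H : Matrix n n ℂ} (hH : H.IsHermitian)
    [Nonempty n] (Q : Matrix n n ℂ) :
    deriv (fun h : ℂ => partitionFn β (H - h • Q)) 0 =
      (β : ℂ) * partitionFn β H * gibbsState β H Q := by
  have h := deriv_partitionFn_sub_smul_ofReal β H Q 0
  simp only [Complex.ofReal_zero, zero_smul, add_zero] at h
  rw [h, gibbsState_apply, Matrix.smul_mul, trace_smul, smul_eq_mul, trace_mul_comm, mul_assoc,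
    ← mul_assoc (partitionFn β H), mul_inv_cancel₀ (partitionFn_pos β hH).ne', one_mul]
  rfl

/-- **An even source has zero expectation**: if `Z(-h) = Z(h)` for all complex `h` then
`⟨Q⟩_{β,H} = 0` (`Z'(0) = 0` for an even differentiable `Z`, and `Z'(0) = βZ⟨Q⟩`), for `β ≠ 0`.
[folklore] -/
theorem gibbsState_eq_zero_of_even {β : ℝ} (hβ : β ≠ 0) {H : Matrix n n ℂ} (hH : H.IsHermitian)
    [Nonempty n] {Q : Matrix n n ℂ}
    (heven : ∀ h : ℂ, partitionFn β (H - (-h) • Q) = partitionFn β (H - h • Q)) :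
    gibbsState β H Q = 0 := by
  set F : ℂ → ℂ := fun h => partitionFn β (H - h • Q) with hF
  have hFe : (fun h => F (-h)) = F := funext fun h => heven h
  have hd : deriv F 0 = 0 := by
    have h1 : deriv (fun h => F (-h)) 0 = -deriv F (-0) := deriv_comp_neg F 0
    rw [hFe, neg_zero] at h1
    linear_combination h1 / 2
  have h2 := deriv_partitionFn_sub_smul_zero β hH Q
  rw [hd] at h2
  have hZ : (β : ℂ) * partitionFn β H ≠ 0 :=
    mul_ne_zero (by exact_mod_cast hβ) (partitionFn_pos β hH).ne'
  exact (mul_eq_zero.1 h2.symm).resolve_left hZ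

/-! ### The Lee–Yang-cone bound on the non-linear response -/

omit [Fintype n] [DecidableEq n] in
/-- A positive complex number (`ComplexOrder`) has norm equal to its real part. [folklore] -/
theorem norm_eq_re_of_pos {z : ℂ} (hz : 0 < z) : ‖z‖ = z.re := by
  obtain ⟨hre, him⟩ := Complex.pos_iff.1 hz
  have hz' : z = (z.re : ℂ) := by
    apply Complex.ext <;> simp [← him]
  rw [hz', Complex.norm_real, Real.norm_eq_abs, abs_of_pos hre, Complex.ofReal_re]

/-- **Zeros of the complex-sourced partition function in an imaginary cone bound the sourced
pressure gain by the linear response.** Let `H, Q` be Hermitian on a nonempty finite-dimensional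
system, `0 < β`, suppose `Z(h) = tr e^{-β(H - hQ)}` is even in the complex source `h` (e.g. by
`partitionFn_sub_neg_smul_eq_of_grading`) and that all its zeros satisfy
`(1 + κ)(Re h)² ≤ (1 - κ)(Im h)²` for some `κ > 0`. Then for every real `s`,
`log Z(H - sQ) - log Z(H) ≤ s² β²/(2κ) · [(Q,Q)_Duhamel - ⟨Q⟩²]` (and `⟨Q⟩ = 0`).
[cite: Newman1975, Thm. 3] [cite: Petz1994, Corollary 6] -/
theorem log_partitionFn_sub_smul_sub_le_of_zeros_in_cone {β : ℝ} (hβ : 0 < β)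
    {H Q : Matrix n n ℂ} (hH : H.IsHermitian) (hQ : Q.IsHermitian) [Nonempty n]
    (heven : ∀ h : ℂ, partitionFn β (H - (-h) • Q) = partitionFn β (H - h • Q))
    {κ : ℝ} (hκ : 0 < κ)
    (hcone : ∀ h : ℂ, partitionFn β (H - h • Q) = 0 → (1 + κ) * h.re ^ 2 ≤ (1 - κ) * h.im ^ 2)
    (s : ℝ) :
    Real.log (partitionFn β (H - (s : ℂ) • Q)).re - Real.log (partitionFn β H).re ≤
      s ^ 2 / (2 * κ) * (β ^ 2 * ((duhamel β H Q Q).re - (gibbsState β H Q).re ^ 2)) := by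
  set F : ℂ → ℂ := fun h => partitionFn β (H - h • Q) with hF
  have hFd : Differentiable ℂ F := differentiable_partitionFn_sub_smul β H Q
  obtain ⟨C, hC⟩ := exists_norm_partitionFn_sub_smul_le β H Q
  have hF0 : F 0 = partitionFn β H := by simp [hF]
  have hZpos : 0 < (partitionFn β H).re := (Complex.pos_iff.1 (partitionFn_pos β hH)).1
  have hF0ne : F 0 ≠ 0 := by
    rw [hF0]; intro h; rw [h] at hZpos; simp at hZpos
  have hevenF : ∀ z, F (-z) = F z := fun z => heven z
  have hmain := Literature.Analysis.Complex.norm_le_exp_sq_of_even_of_zeros_in_cone hFd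
    (σ := 3 / 2) (by norm_num) hC hevenF hF0ne hκ hcone s
  -- identify the norms with the (positive) partition functions
  have hHs : (H - (s : ℂ) • Q).IsHermitian := hH.sub (isHermitian_real_smul hQ s)
  have hZs_pos : 0 < (partitionFn β (H - (s : ℂ) • Q)).re :=
    (Complex.pos_iff.1 (partitionFn_pos β hHs)).1
  have hnormFs : ‖F s‖ = (partitionFn β (H - (s : ℂ) • Q)).re :=
    norm_eq_re_of_pos (partitionFn_pos β hHs)
  have hnormF0 : ‖F 0‖ = (partitionFn β H).re := by
    rw [hF0]; exact norm_eq_re_of_pos (partitionFn_pos β hH)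
  -- the curvature term
  have hcurv : (iteratedDeriv 2 F 0 / F 0).re = β ^ 2 * (duhamel β H Q Q).re := by
    rw [hF0, show iteratedDeriv 2 F 0 = (β : ℂ) ^ 2 * partitionFn β H * duhamel β H Q Q from
      iteratedDeriv_two_partitionFn_sub_smul_eq_duhamel β hH Q]
    have hZne : partitionFn β H ≠ 0 := (partitionFn_pos β hH).ne'
    rw [show (β : ℂ) ^ 2 * partitionFn β H * duhamel β H Q Q / partitionFn β H =
      (β : ℂ) ^ 2 * duhamel β H Q Q by
        rw [mul_right_comm, mul_div_assoc, div_self hZne, mul_one]]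
    rw [show (β : ℂ) ^ 2 = ((β ^ 2 : ℝ) : ℂ) by push_cast; ring, Complex.re_ofReal_mul]
  have hgs : gibbsState β H Q = 0 := gibbsState_eq_zero_of_even hβ.ne' hH heven
  rw [hgs, Complex.zero_re, zero_pow two_ne_zero, sub_zero]
  rw [hnormFs, hnormF0, hcurv] at hmain
  -- take logarithms
  have hlog := Real.log_le_log hZs_pos hmain
  rw [Real.log_mul hZpos.ne' (Real.exp_pos _).ne', Real.log_exp] at hlog
  linarith

/-- **Local form: zeros in an imaginary cone NEAR THE ORIGIN bound the sourced pressure gain.** As in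
`log_partitionFn_sub_smul_sub_le_of_zeros_in_cone`, but the cone condition
`(1 + κ)(Re h)² ≤ (1 - κ)(Im h)²` is only asked of the zeros `h` of `Z` with `|h| ≤ r₀`; the far
zeros cost the constant `Φ = 7β‖Q‖/(r₀ log 2)` (operator norm of the source):
`log Z(H - sQ) - log Z(H) ≤ s² ((β²[(Q,Q) - ⟨Q⟩²]/2 + Φ)/κ + Φ)`. The two real-axis hypotheses of the
underlying `Literature.Analysis.Complex.norm_le_exp_sq_of_even_of_zeros_in_cone_near` are
discharged by Petz's inequality (`norm_partitionFn_complexSource_le_re`) and the Lipschitz bound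
`log_partitionFn_sub_log_partitionFn_le`. [cite: Newman1975, Thm. 3] [cite: Petz1994, Corollary 6] -/
theorem log_partitionFn_sub_smul_sub_le_of_zeros_in_cone_near {β : ℝ} (hβ : 0 < β)
    {H Q : Matrix n n ℂ} (hH : H.IsHermitian) (hQ : Q.IsHermitian) [Nonempty n]
    (heven : ∀ h : ℂ, partitionFn β (H - (-h) • Q) = partitionFn β (H - h • Q))
    {κ r₀ : ℝ} (hκ : 0 < κ) (hr₀ : 0 < r₀)
    (hcone : ∀ h : ℂ, partitionFn β (H - h • Q) = 0 → ‖h‖ ≤ r₀ →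
      (1 + κ) * h.re ^ 2 ≤ (1 - κ) * h.im ^ 2)
    (s : ℝ) :
    Real.log (partitionFn β (H - (s : ℂ) • Q)).re - Real.log (partitionFn β H).re ≤
      s ^ 2 * ((β ^ 2 * ((duhamel β H Q Q).re - (gibbsState β H Q).re ^ 2) / 2 +
          7 * (β * ‖Q‖) / (r₀ * Real.log 2)) / κ + 7 * (β * ‖Q‖) / (r₀ * Real.log 2)) := by
  set F : ℂ → ℂ := fun h => partitionFn β (H - h • Q) with hF
  have hFd : Differentiable ℂ F := differentiable_partitionFn_sub_smul β H Q
  obtain ⟨C, hC⟩ := exists_norm_partitionFn_sub_smul_le β H Q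
  have hF0 : F 0 = partitionFn β H := by simp [hF]
  have hZpos : 0 < (partitionFn β H).re := (Complex.pos_iff.1 (partitionFn_pos β hH)).1
  have hF0ne : F 0 ≠ 0 := by
    rw [hF0]; intro h; rw [h] at hZpos; simp at hZpos
  have hevenF : ∀ z, F (-z) = F z := fun z => heven z
  have hnormF0 : ‖F 0‖ = (partitionFn β H).re := by
    rw [hF0]; exact norm_eq_re_of_pos (partitionFn_pos β hH)
  -- Hermitian real-source Hamiltonians and their positive partition functions
  have hHx : ∀ x : ℝ, (H - (x : ℂ) • Q).IsHermitian := fun x => hH.sub (isHermitian_real_smul hQ x)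
  have hnormFx : ∀ x : ℝ, ‖F x‖ = (partitionFn β (H - (x : ℂ) • Q)).re := fun x =>
    norm_eq_re_of_pos (partitionFn_pos β (hHx x))
  -- (dom) the real axis dominates: Petz
  have hdom : ∀ x y : ℝ, ‖F ((x : ℂ) + (y : ℂ) * Complex.I)‖ ≤ ‖F x‖ := by
    intro x y
    rw [hnormFx]
    exact norm_partitionFn_complexSource_le_re β hH hQ x y
  -- (lip) `Z(x) ≤ Z(0) exp(β ‖Q‖ |x|)`
  have hA : 0 ≤ β * ‖Q‖ := by positivity
  have hlip : ∀ x : ℝ, ‖F x‖ ≤ ‖F 0‖ * Real.exp (β * ‖Q‖ * |x|) := by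
    intro x
    rw [hnormFx, hnormF0]
    have h := log_partitionFn_sub_log_partitionFn_le (hHx x) hH hβ.le (β := β)
    rw [show H - (H - (x : ℂ) • Q) = (x : ℂ) • Q by abel, norm_smul, Complex.norm_real,
      Real.norm_eq_abs] at h
    have hZx : 0 < (partitionFn β (H - (x : ℂ) • Q)).re := (Complex.pos_iff.1 (partitionFn_pos β (hHx x))).1
    have h2 : Real.log (partitionFn β (H - (x : ℂ) • Q)).re ≤
        Real.log ((partitionFn β H).re * Real.exp (β * ‖Q‖ * |x|)) := by
      rw [Real.log_mul hZpos.ne' (Real.exp_pos _).ne', Real.log_exp]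
      nlinarith [abs_nonneg x]
    exact (Real.log_le_log_iff hZx (by positivity)).1 h2
  have hmain := Literature.Analysis.Complex.norm_le_exp_sq_of_even_of_zeros_in_cone_near hFd
    (σ := 3 / 2) (by norm_num) hC hevenF hF0ne hκ hr₀ hA hcone hdom hlip s
  -- the curvature term
  have hcurv : (iteratedDeriv 2 F 0 / F 0).re = β ^ 2 * (duhamel β H Q Q).re := by
    rw [hF0, show iteratedDeriv 2 F 0 = (β : ℂ) ^ 2 * partitionFn β H * duhamel β H Q Q from
      iteratedDeriv_two_partitionFn_sub_smul_eq_duhamel β hH Q]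
    have hZne : partitionFn β H ≠ 0 := (partitionFn_pos β hH).ne'
    rw [show (β : ℂ) ^ 2 * partitionFn β H * duhamel β H Q Q / partitionFn β H =
      (β : ℂ) ^ 2 * duhamel β H Q Q by
        rw [mul_right_comm, mul_div_assoc, div_self hZne, mul_one]]
    rw [show (β : ℂ) ^ 2 = ((β ^ 2 : ℝ) : ℂ) by push_cast; ring, Complex.re_ofReal_mul]
  have hgs : gibbsState β H Q = 0 := gibbsState_eq_zero_of_even hβ.ne' hH heven
  rw [hgs, Complex.zero_re, zero_pow two_ne_zero, sub_zero]
  have hZs_pos : 0 < (partitionFn β (H - (s : ℂ) • Q)).re :=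
    (Complex.pos_iff.1 (partitionFn_pos β (hHx s))).1
  rw [hnormFx, hnormF0, hcurv] at hmain
  have hlog := Real.log_le_log hZs_pos hmain
  rw [Real.log_mul hZpos.ne' (Real.exp_pos _).ne', Real.log_exp] at hlog
  have : (1 : ℝ) / 2 * (β ^ 2 * (duhamel β H Q Q).re) = β ^ 2 * (duhamel β H Q Q).re / 2 := by ring
  rw [this] at hlog
  linarith

end Literature.MathematicalPhysics.QuantumLattice
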